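import Mathlib
import HarnessLib
import Literature.MathematicalPhysics.QuantumLattice.KohnLuttinger
import Literature.MathematicalPhysics.QuantumLattice.HubbardFreeTorusGroundEnergy
import Literature.MathematicalPhysics.QuantumLattice.XYOrderRiemannSumProofs

/-!
# Crux `CwChiralConstruction` (stmt-HubbardSuperconductivity-1740), line `susceptibility-rise-budget`:
# stub `stub_freeBandLimit`

The FREE square-lattice band `ε(p) = -2(cos p₀ + cos p₁)` at `T = 0`. (1) The `U = 0` ground-energy
density `2(L+1)⁻² Σ_k min(ε_{L+1}(k) - μ, 0)` (tree `groundEnergy_hubbardTorusWith_zero`) tends to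
`e₀(μ) = 2(2π)⁻² ∫_{[-π,π]²} min(ε - μ, 0)`: the momenta `2πk/(L+1)` are, mod `2π`, the tags of the
grid cells of `[-π,π)²` (`klsTag_add_centerIndex`), so the sum is the integral of a step function
and dominated convergence applies (`CwFreeBand.tendsto_sum_latticeMomentum_div`, any bounded
continuous periodic integrand). (2) `HasDerivAt e₀ (-filling μ) μ` for EVERY `μ` and continuity of
the filling: `|min(x-ν,0) - min(x-μ,0) + (ν-μ)𝟙[x<μ]| ≤ |ν-μ| 𝟙[|x-μ| ≤ |ν-μ|]`, and the shell
volume `vol{|ε - μ| ≤ |ν - μ|} → 0` because the LEVEL SETS of `ε` are Lebesgue-null (Tonelli on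
`ℝ × ℝ`: every section `{y : cos y = c}` is countable, `Real.cos_eq_cos_iff`). (3) `filling = 0`
for `μ ≤ -4`, `= 2` for `μ > 4` (`|ε| ≤ 4`, `vol [-π,π]² = (2π)²`), after transporting
`KohnLuttinger.filling` from `EuclideanSpace ℝ (Fin 2)` to `Fin 2 → ℝ` by the volume-preserving
`WithLp.toLp`. No definitions; everything is proved.
-/

set_option linter.dupNamespace false

namespace Summit.HubbardSuperconductivity.HubbardSuperconductivity.Theorems

open Literature.MathematicalPhysics.QuantumLattice Literature.Probability.LatticeModels Matrix Filter
open MeasureTheory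
open scoped Matrix.Norms.L2Operator ComplexOrder Topology Real

namespace CwFreeBand

/-! ### One-variable inequality behind `e₀' = -filling` -/

/-- The concave piecewise-linear `μ ↦ min(x - μ, 0)` has slope `-𝟙[x < μ]` up to an error
supported where `x` lies between `μ` and `ν`:
`|min(x-ν,0) - min(x-μ,0) + (ν-μ)𝟙[x<μ]| ≤ |ν-μ| 𝟙[|x-μ| ≤ |ν-μ|]`. [folklore] -/
theorem abs_min_sub_min_add_mul_ite_le (x μ ν : ℝ) :
    |min (x - ν) 0 - min (x - μ) 0 + (ν - μ) * (if x < μ then (1 : ℝ) else 0)| ≤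
      |ν - μ| * (if |x - μ| ≤ |ν - μ| then (1 : ℝ) else 0) := by
  have h0 : 0 ≤ |ν - μ| * (if |x - μ| ≤ |ν - μ| then (1 : ℝ) else 0) := by
    have : (0 : ℝ) ≤ if |x - μ| ≤ |ν - μ| then (1 : ℝ) else 0 := by split_ifs <;> norm_num
    positivity
  rcases lt_or_ge x μ with hxμ | hxμ
  · rw [if_pos hxμ, mul_one, min_eq_left (sub_nonpos.2 hxμ.le)]
    rcases lt_or_ge x ν with hxν | hxν
    · rw [min_eq_left (sub_nonpos.2 hxν.le)]
      have : x - ν - (x - μ) + (ν - μ) = 0 := by ring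
      rw [this, abs_zero]
      exact h0
    · rw [min_eq_right (sub_nonneg.2 hxν)]
      have hin : |x - μ| ≤ |ν - μ| := by
        rw [abs_of_neg (sub_neg.2 hxμ), abs_of_nonpos (sub_nonpos.2 (hxν.trans hxμ.le))]
        linarith
      rw [if_pos hin, mul_one, abs_of_nonpos (sub_nonpos.2 (hxν.trans hxμ.le)), abs_le]
      constructor <;> linarith
  · rw [if_neg (not_lt.2 hxμ), mul_zero, add_zero, min_eq_right (sub_nonneg.2 hxμ), sub_zero]
    rcases lt_or_ge x ν with hxν | hxν
    · rw [min_eq_left (sub_nonpos.2 hxν.le)]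
      have hin : |x - μ| ≤ |ν - μ| := by
        rw [abs_of_nonneg (sub_nonneg.2 hxμ), abs_of_pos (sub_pos.2 (hxμ.trans_lt hxν))]
        linarith
      rw [if_pos hin, mul_one, abs_of_pos (sub_pos.2 (hxμ.trans_lt hxν)), abs_le]
      constructor <;> linarith
    · rw [min_eq_right (sub_nonneg.2 hxν), abs_zero]
      exact h0

/-! ### Level-set-null band functions: shell volume, derivative, continuity -/

variable {X : Type*} [MeasurableSpace X] {m : Measure X}

/-- An indicator `𝟙[P]` of a measurable set is integrable for a finite measure. [folklore] -/
theorem integrable_ite_one [IsFiniteMeasure m] {P : X → Prop} [DecidablePred P]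
    (hP : MeasurableSet {p | P p}) : Integrable (fun p => if P p then (1 : ℝ) else 0) m :=
  Integrable.of_bound (Measurable.ite hP measurable_const measurable_const).aestronglyMeasurable 1
    (Eventually.of_forall fun p => by split_ifs <;> simp)

/-- If the level set `{g = μ}` is `m`-null (`m` finite), the shell volume
`∫ 𝟙[|g - μ| ≤ |ν - μ|] dm → 0` as `ν → μ` (dominated convergence along `𝓝 μ`). [folklore] -/
theorem tendsto_integral_ite_abs_le [IsFiniteMeasure m] {g : X → ℝ} (hg : Measurable g) {μ : ℝ}
    (hnull : ∀ᵐ p ∂m, g p ≠ μ) :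
    Tendsto (fun ν : ℝ => ∫ p, (if |g p - μ| ≤ |ν - μ| then (1 : ℝ) else 0) ∂m) (𝓝 μ) (𝓝 0) := by
  have habs : Tendsto (fun ν : ℝ => |ν - μ|) (𝓝 μ) (𝓝 0) := by
    simpa using ((continuous_sub_right μ).abs).tendsto μ
  have hset : ∀ ν : ℝ, MeasurableSet {p | |g p - μ| ≤ |ν - μ|} := fun ν =>
    measurableSet_le (continuous_abs.measurable.comp (hg.sub_const μ)) measurable_const
  have h := tendsto_integral_filter_of_dominated_convergence (μ := m) (l := 𝓝 μ)
    (F := fun (ν : ℝ) (p : X) => if |g p - μ| ≤ |ν - μ| then (1 : ℝ) else 0) (f := fun _ => 0)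
    (fun _ => (1 : ℝ)) (Eventually.of_forall fun ν => (integrable_ite_one (hset ν)).1)
    (Eventually.of_forall fun ν => Eventually.of_forall fun p => by split_ifs <;> simp)
    (integrable_const (1 : ℝ)) ?_
  · simpa using h
  · filter_upwards [hnull] with p hp
    refine tendsto_const_nhds.congr' ?_
    filter_upwards [(tendsto_order.1 habs).2 _ (abs_pos.2 (sub_ne_zero.2 hp))] with ν hν
    rw [if_neg (not_le.2 hν)]

/-- **`d/dμ ∫ min(g - μ, 0) dm = -m{g < μ}`** at every `μ` whose level set `{g = μ}` is `m`-null
(`m` finite, `g` integrable): the error is at most `|ν - μ|` times the shell volume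
`m{|g - μ| ≤ |ν - μ|} → 0`. [folklore] -/
theorem hasDerivAt_integral_min_sub [IsFiniteMeasure m] {g : X → ℝ} (hg : Measurable g)
    (hgi : Integrable g m) {μ : ℝ} (hnull : ∀ᵐ p ∂m, g p ≠ μ) :
    HasDerivAt (fun ν : ℝ => ∫ p, min (g p - ν) 0 ∂m)
      (-∫ p, (if g p < μ then (1 : ℝ) else 0) ∂m) μ := by
  have hGi : ∀ ν : ℝ, Integrable (fun p => min (g p - ν) 0) m := fun ν => by
    refine (hgi.norm.add (integrable_const |ν|)).mono'
      ((hg.sub_const ν).min measurable_const).aestronglyMeasurable (Eventually.of_forall fun p => ?_)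
    simp only [Pi.add_apply, Real.norm_eq_abs]
    rcases le_total (g p - ν) 0 with h | h
    · rw [min_eq_left h]
      exact abs_sub _ _
    · rw [min_eq_right h, abs_zero]
      positivity
  have hFi : Integrable (fun p => if g p < μ then (1 : ℝ) else 0) m :=
    integrable_ite_one (measurableSet_lt hg measurable_const)
  have hIi : ∀ ν : ℝ, Integrable (fun p => if |g p - μ| ≤ |ν - μ| then (1 : ℝ) else 0) m := fun ν =>
    integrable_ite_one (measurableSet_le (continuous_abs.measurable.comp (hg.sub_const μ))
      measurable_const)
  rw [hasDerivAt_iff_isLittleO, Asymptotics.isLittleO_iff]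
  intro c hc
  filter_upwards [(tendsto_order.1 (tendsto_integral_ite_abs_le hg hnull)).2 c hc] with ν hν
  have hdecomp : (∫ p, min (g p - ν) 0 ∂m) - (∫ p, min (g p - μ) 0 ∂m) -
      (ν - μ) • (-∫ p, (if g p < μ then (1 : ℝ) else 0) ∂m) =
      ∫ p, (min (g p - ν) 0 - min (g p - μ) 0 + (ν - μ) * (if g p < μ then (1 : ℝ) else 0)) ∂m := by
    have hABi : Integrable (fun p => min (g p - ν) 0 - min (g p - μ) 0) m := (hGi ν).sub (hGi μ)
    have hCDi : Integrable (fun p => (ν - μ) * (if g p < μ then (1 : ℝ) else 0)) m :=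
      hFi.const_mul _
    rw [integral_add hABi hCDi, integral_sub (hGi ν) (hGi μ), integral_const_mul, smul_eq_mul]
    ring
  rw [hdecomp]
  calc ‖∫ p, (min (g p - ν) 0 - min (g p - μ) 0 + (ν - μ) * (if g p < μ then (1 : ℝ) else 0)) ∂m‖
      ≤ ∫ p, ‖min (g p - ν) 0 - min (g p - μ) 0 + (ν - μ) * (if g p < μ then (1 : ℝ) else 0)‖ ∂m :=
        norm_integral_le_integral_norm _
    _ ≤ ∫ p, |ν - μ| * (if |g p - μ| ≤ |ν - μ| then (1 : ℝ) else 0) ∂m := by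
        refine integral_mono_of_nonneg (Eventually.of_forall fun p => norm_nonneg _)
          ((hIi ν).const_mul _) (Eventually.of_forall fun p => ?_)
        dsimp only
        rw [Real.norm_eq_abs]
        exact abs_min_sub_min_add_mul_ite_le (g p) μ ν
    _ = |ν - μ| * ∫ p, (if |g p - μ| ≤ |ν - μ| then (1 : ℝ) else 0) ∂m := integral_const_mul _ _
    _ ≤ |ν - μ| * c := by gcongr
    _ = c * ‖ν - μ‖ := by rw [Real.norm_eq_abs, mul_comm]

/-- **Continuity of `μ ↦ m{g < μ}`** at every `μ` whose level set `{g = μ}` is `m`-null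
(`m` finite): dominated convergence along `𝓝 μ` (off the level set the indicator is eventually
constant). [folklore] -/
theorem continuousAt_integral_ite_lt [IsFiniteMeasure m] {g : X → ℝ} (hg : Measurable g) {μ : ℝ}
    (hnull : ∀ᵐ p ∂m, g p ≠ μ) :
    ContinuousAt (fun ν : ℝ => ∫ p, (if g p < ν then (1 : ℝ) else 0) ∂m) μ := by
  refine tendsto_integral_filter_of_dominated_convergence (fun _ => (1 : ℝ))
    (Eventually.of_forall fun ν => (integrable_ite_one (measurableSet_lt hg measurable_const)).1)
    (Eventually.of_forall fun ν => Eventually.of_forall fun p => by split_ifs <;> simp)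
    (integrable_const (1 : ℝ)) ?_
  filter_upwards [hnull] with p hp
  rcases lt_or_gt_of_ne hp with h | h
  · rw [if_pos h]
    refine tendsto_const_nhds.congr' ?_
    filter_upwards [eventually_gt_nhds h] with ν hν
    rw [if_pos hν]
  · rw [if_neg (not_lt.2 h.le)]
    refine tendsto_const_nhds.congr' ?_
    filter_upwards [eventually_lt_nhds h] with ν hν
    rw [if_neg (not_lt.2 hν.le)]

/-! ### The level sets of the square-lattice band are Lebesgue-null -/

/-- `{y : cos y = c}` is countable (`cos y = cos y₀ ↔ y = 2kπ ± y₀`). [folklore] -/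
theorem countable_setOf_cos_eq (c : ℝ) : Set.Countable {y : ℝ | Real.cos y = c} := by
  by_cases h : ∃ y₀, Real.cos y₀ = c
  · obtain ⟨y₀, hy₀⟩ := h
    have hsub : {y : ℝ | Real.cos y = c} ⊆
        ⋃ k : ℤ, ({2 * (k : ℝ) * π + y₀, 2 * (k : ℝ) * π - y₀} : Set ℝ) := by
      intro y hy
      obtain ⟨k, hk⟩ := Real.cos_eq_cos_iff.1 (hy₀.trans (Eq.symm hy))
      exact Set.mem_iUnion.2 ⟨k, hk.elim Or.inl Or.inr⟩
    exact (Set.countable_iUnion fun k => ((Set.countable_singleton _).insert _)).mono hsub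
  · push Not at h
    rw [Set.eq_empty_of_forall_notMem (s := {y : ℝ | Real.cos y = c}) fun y hy => h y hy]
    exact Set.countable_empty

/-- **The level sets of `ε(p) = -2(cos p₀ + cos p₁)` are Lebesgue-null** in `ℝ²` (Tonelli: each
section `{y : -2(cos x + cos y) = μ}` is countable, hence null). [folklore] -/
theorem volume_setOf_band_eq (μ : ℝ) :
    volume {p : Fin 2 → ℝ | -2 * ∑ i, Real.cos (p i) = μ} = 0 := by
  set S : Set (ℝ × ℝ) := {q | -2 * (Real.cos q.1 + Real.cos q.2) = μ} with hS
  have hSm : MeasurableSet S := measurableSet_eq_fun (by fun_prop) measurable_const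
  have hpre : {p : Fin 2 → ℝ | -2 * ∑ i, Real.cos (p i) = μ} =
      MeasurableEquiv.finTwoArrow ⁻¹' S := by
    ext p
    simp [hS, Fin.sum_univ_two]
  rw [hpre, (volume_preserving_finTwoArrow ℝ).measure_preimage hSm.nullMeasurableSet,
    Measure.volume_eq_prod, Measure.measure_prod_null hSm]
  refine Eventually.of_forall fun x => ?_
  have hsub : Prod.mk x ⁻¹' S ⊆ {y : ℝ | Real.cos y = -μ / 2 - Real.cos x} := by
    intro y hy
    have hy' : -2 * (Real.cos x + Real.cos y) = μ := hy
    show Real.cos y = -μ / 2 - Real.cos x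
    linarith
  exact measure_mono_null hsub ((countable_setOf_cos_eq _).measure_zero volume)

/-! ### Riemann sums over the momenta of the torus -/

/-- **Momentum sums to Brillouin-zone integrals**: for `f` continuous, bounded and `2π`-periodic
in every coordinate, `(L+1)^{-ν} Σ_{k ∈ (ℤ/(L+1)ℤ)^ν} f(2πk/(L+1)) → (2π)^{-ν} ∫_{[-π,π]^ν} f`.
The momenta are congruent mod `2π` to the tags `t_j` of the grid cells of `[-π,π)^ν`, so the sum
is `(2π)^{-ν}` times the integral of the step function `Σ_j f(t_j) 𝟙_{cell j}`, which converges
to `f` on `[-π,π)^ν` and is dominated by `sup|f| 𝟙_{[-π,π)^ν}` (Friedli–Velenik 2017 §10.4,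
"passing from sums to integrals"). [folklore] -/
theorem tendsto_sum_latticeMomentum_div {ν : ℕ} {f : (Fin ν → ℝ) → ℝ} (hf : Continuous f)
    {M : ℝ} (hM : ∀ p, |f p| ≤ M)
    (hper : ∀ (p : Fin ν → ℝ) (q : Fin ν → ℤ), f (fun i => p i + 2 * π * (q i : ℝ)) = f p) :
    Tendsto (fun L : ℕ => (∑ k : TorusSite ν (L + 1), f (latticeMomentum (L + 1) k)) /
      ((L + 1 : ℕ) : ℝ) ^ ν) atTop (𝓝 ((∫ p in brillouin ν, f p) / (2 * π) ^ ν)) := by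
  -- (a) the momentum sum is `(2π)^{-ν}` times the integral of the step function on the tags
  have hstep : ∀ (L : ℕ) [NeZero L],
      (∑ k : TorusSite ν L, f (latticeMomentum L k)) / (L : ℝ) ^ ν =
        (∫ p, ∑ j : TorusSite ν L,
          (gridCell j).indicator (fun _ => f fun i => gridStep L * (cellOffset j i : ℝ)) p) /
          (2 * π) ^ ν := by
    intro L _
    have hsum : ∑ k : TorusSite ν L, f (latticeMomentum L k) =
        ∑ j : TorusSite ν L, f fun i => gridStep L * (cellOffset j i : ℝ) := by
      have hterm : ∀ k : TorusSite ν L, f (latticeMomentum L k) =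
          f (fun i => gridStep L * (cellOffset (k + centerIndex ν L) i : ℝ)) := fun k => by
        obtain ⟨q, hq⟩ := klsTag_add_centerIndex k
        rw [hq, hper (latticeMomentum L k) q]
      simp_rw [hterm]
      exact Equiv.sum_comp (Equiv.addRight (centerIndex ν L))
        (fun j => f fun i => gridStep L * (cellOffset j i : ℝ))
    rw [integral_sum_indicator_gridCell, hsum]
    have hL : (L : ℝ) ≠ 0 := by exact_mod_cast NeZero.ne L
    have h2π : (2 * π : ℝ) ≠ 0 := by positivity
    unfold gridStep
    rw [div_pow]
    field_simp
  -- (b) dominated convergence for the step functions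
  have hmeasH : MeasurableSet (halfOpenBrillouin ν) :=
    MeasurableSet.univ_pi fun _ => measurableSet_Ico
  have hvol : volume (halfOpenBrillouin ν) < ⊤ :=
    (measure_mono (halfOpenBrillouin_subset_brillouin ν)).trans_lt
      (isCompact_brillouin ν).measure_lt_top
  have hcellOf : ∀ (L : ℕ) {p : Fin ν → ℝ}, p ∈ halfOpenBrillouin ν →
      ∃ j : TorusSite ν (L + 1), p ∈ gridCell j := fun L p hp => by
    have h : p ∈ ⋃ j : TorusSite ν (L + 1), gridCell j := by rwa [iUnion_gridCell ν (L + 1)]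
    exact Set.mem_iUnion.1 h
  have hDCT : Tendsto (fun L : ℕ => ∫ p, ∑ j : TorusSite ν (L + 1),
      (gridCell j).indicator (fun _ => f fun i => gridStep (L + 1) * (cellOffset j i : ℝ)) p)
      atTop (𝓝 (∫ p, (halfOpenBrillouin ν).indicator f p)) := by
    refine tendsto_integral_of_dominated_convergence ((halfOpenBrillouin ν).indicator fun _ => M)
      (fun L => (measurable_sum_indicator_gridCell _ _).aestronglyMeasurable)
      ((integrableOn_const hvol.ne).integrable_indicator hmeasH)
      (fun L => Eventually.of_forall fun p => ?_) (Eventually.of_forall fun p => ?_)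
    · by_cases hp : p ∈ halfOpenBrillouin ν
      · obtain ⟨j, hpj⟩ := hcellOf L hp
        rw [sum_indicator_gridCell_eq_of_mem _ (Finset.mem_univ j) hpj, Set.indicator_of_mem hp,
          Real.norm_eq_abs]
        exact hM _
      · rw [sum_indicator_gridCell_eq_zero_of_not_mem _ _ hp, Set.indicator_of_notMem hp,
          norm_zero]
    · by_cases hp : p ∈ halfOpenBrillouin ν
      · rw [Set.indicator_of_mem hp]
        choose j hj using fun L => hcellOf L hp
        have hδ : Tendsto (fun L : ℕ => gridStep (L + 1)) atTop (𝓝 0) :=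
          tendsto_const_nhds.div_atTop
            (tendsto_natCast_atTop_atTop.comp (tendsto_add_atTop_nat 1))
        have htag : Tendsto (fun L : ℕ => fun i => gridStep (L + 1) * (cellOffset (j L) i : ℝ))
            atTop (𝓝 p) := by
          rw [tendsto_iff_norm_sub_tendsto_zero]
          refine squeeze_zero (fun L => norm_nonneg _) (fun L => ?_) hδ
          rw [norm_sub_rev]
          exact norm_sub_klsTag_le (hj L)
        refine ((hf.tendsto p).comp htag).congr fun L => ?_
        exact (sum_indicator_gridCell_eq_of_mem
          (fun j' => f fun i => gridStep (L + 1) * (cellOffset j' i : ℝ))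
          (Finset.mem_univ _) (hj L)).symm
      · rw [Set.indicator_of_notMem hp]
        simp only [sum_indicator_gridCell_eq_zero_of_not_mem _ _ hp]
        exact tendsto_const_nhds
  have hlimit : ∫ p, (halfOpenBrillouin ν).indicator f p = ∫ p in brillouin ν, f p := by
    rw [integral_indicator hmeasH]
    exact setIntegral_congr_set (halfOpenBrillouin_ae_eq_brillouin ν)
  rw [hlimit] at hDCT
  exact (hDCT.div_const ((2 * π) ^ ν)).congr fun L => (hstep (L + 1)).symm

/-! ### The filling of `squareDispersion 1 0`, transported to `Fin 2 → ℝ` -/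

/-- The filling of the nearest-neighbour band as an integral over `[-π,π]² ⊆ (Fin 2 → ℝ)`:
`filling μ = 2 (2π)⁻² ∫_{[-π,π]²} 𝟙[-2 Σ cos pᵢ < μ]` (`WithLp.toLp : (Fin 2 → ℝ) → Momentum` is
volume preserving and pulls `brillouinZone` back to `[-π,π)²`, which is `[-π,π]²` a.e.).
[folklore] -/
theorem filling_eq (μ : ℝ) :
    KohnLuttinger.filling (squareDispersion 1 0) μ =
      2 * (∫ p in brillouin 2, (if -2 * ∑ i, Real.cos (p i) < μ then (1 : ℝ) else 0)) /
        (2 * π) ^ 2 := by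
  rw [KohnLuttinger.filling, ← (PiLp.volume_preserving_toLp (Fin 2)).setIntegral_preimage_emb
    (MeasurableEquiv.toLp 2 (Fin 2 → ℝ)).measurableEmbedding]
  have hpre : (WithLp.toLp 2) ⁻¹' brillouinZone = halfOpenBrillouin 2 := by
    ext x
    simp [brillouinZone, halfOpenBrillouin]
  rw [hpre, setIntegral_congr_set (halfOpenBrillouin_ae_eq_brillouin 2)]
  congr 2
  refine integral_congr_ae (Eventually.of_forall fun x => ?_)
  have hx : squareDispersion 1 0 (WithLp.toLp 2 x) = -2 * ∑ i, Real.cos (x i) := by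
    simp [squareDispersion, Fin.sum_univ_two]
  simp only [fermiOccupation, hx]

/-- `vol [-π,π]² = (2π)²`. [folklore] -/
theorem volume_brillouin_two_toReal : (volume (brillouin 2)).toReal = (2 * π) ^ 2 := by
  rw [brillouin, Set.pi_univ_Icc, Real.volume_Icc_pi_toReal (fun _ => by linarith [Real.pi_pos])]
  simp only [sub_neg_eq_add, Finset.prod_const, Finset.card_univ, Fintype.card_fin]
  ring

end CwFreeBand

/-- **Stub `stub_freeBandLimit`** (the free band `ε = -2(cos p₀ + cos p₁)` at `T = 0`): the free
(`U = 0`) ground-energy density `2(L+1)⁻² Σ_k min(ε_{L+1}(k) - μ, 0)` (tree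
`groundEnergy_hubbardTorusWith_zero`) converges to `e₀(μ) = 2∫_BZ min(ε - μ, 0) dp/(2π)²`
(Riemann sums), `e₀' = -filling` everywhere and the filling is continuous (level sets of `ε` are
null), `= 0` below the band and `= 2` above it (`vol BZ = (2π)²`). [folklore] -/
theorem stub_freeBandLimit :
    ∃ e₀ : ℝ → ℝ, (∀ μ : ℝ, Tendsto (fun L : ℕ => (hubbardTorusWith 2 (L + 1) 1 0 μ).groundEnergy / ((L + 1 : ℕ) : ℝ) ^ 2) atTop (𝓝 (e₀ μ))) ∧ (∀ μ : ℝ, HasDerivAt e₀ (-KohnLuttinger.filling (squareDispersion 1 0) μ) μ) ∧ Continuous (fun μ : ℝ => KohnLuttinger.filling (squareDispersion 1 0) μ) ∧ (∀ μ : ℝ, μ ≤ -4 → KohnLuttinger.filling (squareDispersion 1 0) μ = 0) ∧ (∀ μ : ℝ, 4 < μ → KohnLuttinger.filling (squareDispersion 1 0) μ = 2) := by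
  have hcont : Continuous fun p : Fin 2 → ℝ => -2 * ∑ i, Real.cos (p i) := by fun_prop
  have hband : ∀ p : Fin 2 → ℝ, -4 ≤ -2 * ∑ i, Real.cos (p i) ∧ -2 * ∑ i, Real.cos (p i) ≤ 4 := by
    intro p
    rw [Fin.sum_univ_two]
    obtain ⟨h1, h2⟩ := abs_le.1 (Real.abs_cos_le_one (p 0))
    obtain ⟨h3, h4⟩ := abs_le.1 (Real.abs_cos_le_one (p 1))
    constructor <;> linarith
  haveI hfin : IsFiniteMeasure (volume.restrict (brillouin 2)) :=
    isFiniteMeasure_restrict.2 (isCompact_brillouin 2).measure_lt_top.ne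
  have hint : Integrable (fun p : Fin 2 → ℝ => -2 * ∑ i, Real.cos (p i))
      (volume.restrict (brillouin 2)) :=
    hcont.continuousOn.integrableOn_compact (isCompact_brillouin 2)
  have hnull : ∀ μ : ℝ, ∀ᵐ p ∂(volume.restrict (brillouin 2)), -2 * ∑ i, Real.cos (p i) ≠ μ :=
    fun μ => ae_restrict_of_ae (by
      rw [ae_iff]
      simpa using CwFreeBand.volume_setOf_band_eq μ)
  have h2π : (0 : ℝ) < (2 * π) ^ 2 := by positivity
  refine ⟨fun μ => 2 * (∫ p in brillouin 2, min (-2 * ∑ i, Real.cos (p i) - μ) 0) / (2 * π) ^ 2,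
    fun μ => ?_, fun μ => ?_, ?_, fun μ hμ => ?_, fun μ hμ => ?_⟩
  · -- (1) the free ground-energy density: Riemann sums of `min(ε - μ, 0)`
    have hf : Continuous fun p : Fin 2 → ℝ => min (-2 * ∑ i, Real.cos (p i) - μ) 0 := by fun_prop
    have hM : ∀ p : Fin 2 → ℝ, |min (-2 * ∑ i, Real.cos (p i) - μ) 0| ≤ 4 + |μ| := fun p => by
      obtain ⟨h1, h2⟩ := hband p
      obtain ⟨h3, h4⟩ := abs_le.1 (le_refl |μ|)
      rw [abs_le]
      constructor
      · rcases le_total (-2 * ∑ i, Real.cos (p i) - μ) 0 with h | h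
        · rw [min_eq_left h]; linarith
        · rw [min_eq_right h]; linarith
      · exact (min_le_right _ _).trans (by linarith)
    have hper : ∀ (p : Fin 2 → ℝ) (q : Fin 2 → ℤ),
        min (-2 * ∑ i, Real.cos (p i + 2 * π * (q i : ℝ)) - μ) 0 =
          min (-2 * ∑ i, Real.cos (p i) - μ) 0 := by
      intro p q
      have : ∀ i, Real.cos (p i + 2 * π * (q i : ℝ)) = Real.cos (p i) := fun i => by
        rw [show p i + 2 * π * (q i : ℝ) = p i + (q i : ℝ) * (2 * π) by ring,
          Real.cos_add_int_mul_two_pi]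
      simp only [this]
    have h := (CwFreeBand.tendsto_sum_latticeMomentum_div hf hM hper).const_mul 2
    rw [← mul_div_assoc] at h
    refine h.congr' ?_
    filter_upwards [eventually_ge_atTop 2] with L hL
    rw [groundEnergy_hubbardTorusWith_zero (show 3 ≤ L + 1 by omega) μ, mul_div_assoc]
    simp only [torusBand]
  · -- (2) `e₀' = -filling`
    have h := ((CwFreeBand.hasDerivAt_integral_min_sub hcont.measurable hint (hnull μ)).const_mul
      2).div_const ((2 * π) ^ 2)
    refine h.congr_deriv ?_
    rw [CwFreeBand.filling_eq]
    ring
  · -- (3) continuity of the filling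
    have h : Continuous fun μ : ℝ =>
        ∫ p in brillouin 2, (if -2 * ∑ i, Real.cos (p i) < μ then (1 : ℝ) else 0) :=
      continuous_iff_continuousAt.2 fun μ =>
        CwFreeBand.continuousAt_integral_ite_lt hcont.measurable (hnull μ)
    simp_rw [CwFreeBand.filling_eq]
    exact (continuous_const.mul h).div_const _
  · -- (4) below the band
    rw [CwFreeBand.filling_eq]
    have h0 : (fun p : Fin 2 → ℝ => if -2 * ∑ i, Real.cos (p i) < μ then (1 : ℝ) else 0) =
        fun _ => 0 :=
      funext fun p => if_neg (not_lt.2 (hμ.trans (hband p).1))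
    rw [h0, integral_zero]
    simp
  · -- (5) above the band
    rw [CwFreeBand.filling_eq]
    have h1 : (fun p : Fin 2 → ℝ => if -2 * ∑ i, Real.cos (p i) < μ then (1 : ℝ) else 0) =
        fun _ => 1 :=
      funext fun p => if_pos ((hband p).2.trans_lt hμ)
    rw [h1, setIntegral_const, smul_eq_mul, mul_one, measureReal_def,
      CwFreeBand.volume_brillouin_two_toReal]
    field_simp

end Summit.HubbardSuperconductivity.HubbardSuperconductivity.Theorems
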